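import Summits.AtomisticToContinuum.Crystallization.Theorems.FrustratedLawDichotomyMotifLemmas

/-!
# FrustratedLawDichotomy · RULE TOOLKIT: local site features and pair rules with CERTIFIED range / locality / bound

`…LocalDischargingRule` (hand-2 g12, critic row 487 (2a)) asks a census engine to SEARCH transfer rules `F` with `HasRange R′ F`, `IsLocal ρ F`,
`IsBounded B F`.  This file gives the engine a constructor whose three restrictions are THEOREMS, so that a found rule lands without ad-hoc
locality proofs:

* §1 `SiteFeature`, `IsLocalFeature ρ f` (a per-site real read off the `ρ`-neighbourhood: invariance under sub-clusters `y ∘ φ` containing every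
  atom within `ρ` of the site) with two PROVED instances: `coordFeature r` (number of other atoms within `r`, a filtered cardinality; local for `r ≤ ρ`) and
  `truncEnergyFeature r` (`Σ_k truncLJ r (r_ik)`, twice the range-`r` site energy; local for `r ≤ ρ`); `IsLocalFeature.mono`;
* §2 `pairRule g f` — «site `i` sends `g (r_ij) (f_i) (f_j)` to `j ≠ i`» — with
  `pairRule_hasRange` (`g d · · = 0` for `d > R′`), ★ `pairRule_isLocal` (`f` `ρ`-local ⟹ the rule is `ρ`-local), `pairRule_isBounded` (`|g| ≤ B`);
* §3 the generic sub-cluster summation lemmas used (`sum_comp_eq_sum_of_vanish`).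

Typical certified search space: `g d a b = clip_B (𝟙[d ≤ R′] · P(d, a, b))` with `P` piecewise-polynomial and `f ∈ {coordFeature r, truncEnergyFeature r}`
(«energy / coordination flows from rich to poor sites within `R′`»).  [folklore] bookkeeping; 0 sorry.  Prover hand 2, gen 12 (decomp-a2c),
`--supports stmt-AtomisticToContinuum-27623`.
-/

noncomputable section

namespace Summit.AtomisticToContinuum.Crystallization.Theorems.FrustratedLawDichotomyRuleToolkit

open scoped BigOperators Classical
open Summit.AtomisticToContinuum.Crystallization.Theorems.ChargedEnergyGapNegative (E3)
open Summit.AtomisticToContinuum.Crystallization.Theorems.FrustratedLawDichotomyRangeCut (truncLJ)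
open Summit.AtomisticToContinuum.Crystallization.Theorems.FrustratedLawDichotomyLocalDischargingRule
open Summit.AtomisticToContinuum.Crystallization.Theorems.FrustratedLawDichotomyMotifLemmas (truncLJ_of_le)

/-! ## §1. Local site features -/

/-- **A SITE FEATURE**: for every finite cluster a real per site. -/
abbrev SiteFeature : Type := ∀ N : ℕ, (Fin N → E3) → Fin N → ℝ

/-- **LOCALITY of radius `ρ` for a site feature**: unchanged under passing to any sub-cluster `y ∘ φ` (`φ` injective) containing every atom of `y`
within `ρ` of the site. -/
def IsLocalFeature (ρ : ℝ) (f : SiteFeature) : Prop :=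
  ∀ (N M : ℕ) (y : Fin N → E3) (φ : Fin M → Fin N), Function.Injective φ →
    ∀ a : Fin M, (∀ k : Fin N, dist (y k) (y (φ a)) ≤ ρ → k ∈ Set.range φ) → f M (y ∘ φ) a = f N y (φ a)

/-- `IsLocalFeature` is monotone in the radius. [folklore] -/
theorem IsLocalFeature.mono {ρ ρ' : ℝ} {f : SiteFeature} (h : IsLocalFeature ρ f) (hle : ρ ≤ ρ') : IsLocalFeature ρ' f :=
  fun N M y φ hφ a hsub => h N M y φ hφ a fun k hk => hsub k (hk.trans hle)

/-- **Coordination feature** `coordFeature r N y i = #{k ≠ i : dist (y k) (y i) ≤ r}` (as a real). -/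
def coordFeature (r : ℝ) : SiteFeature := fun N y i =>
  ((Finset.univ.filter fun k : Fin N => k ≠ i ∧ dist (y k) (y i) ≤ r).card : ℝ)

/-- **Truncated-energy feature** `truncEnergyFeature r N y i = Σ_k truncLJ r (dist (y i) (y k))` (twice the range-`r` site energy). -/
def truncEnergyFeature (r : ℝ) : SiteFeature := fun N y i => ∑ k : Fin N, truncLJ r (dist (y i) (y k))

/-! ## §3 (used by §1–§2). Sub-cluster summation -/

/-- A sum over a sub-cluster `φ` of `h ∘ φ` equals the full sum of `h` when `h` vanishes off the range of `φ`. [folklore] -/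
theorem sum_comp_eq_sum_of_vanish {N M : ℕ} {φ : Fin M → Fin N} (hφ : Function.Injective φ) (h : Fin N → ℝ)
    (hvan : ∀ j, j ∉ Set.range φ → h j = 0) : ∑ a : Fin M, h (φ a) = ∑ j : Fin N, h j := by
  have e1 : ∑ a : Fin M, h (φ a) = ∑ j ∈ (Finset.univ : Finset (Fin M)).map ⟨φ, hφ⟩, h j := by
    rw [Finset.sum_map]
    rfl
  rw [e1]
  refine Finset.sum_subset (Finset.subset_univ _) fun j _ hj => hvan j fun ⟨a, ha⟩ => hj ?_
  exact Finset.mem_map.mpr ⟨a, Finset.mem_univ a, ha⟩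

/-- ★ `coordFeature r` is `ρ`-local for `r ≤ ρ`. [folklore] -/
theorem coordFeature_isLocal {r ρ : ℝ} (hr : r ≤ ρ) : IsLocalFeature ρ (coordFeature r) := by
  intro N M y φ hφ a hsub
  unfold coordFeature
  have hmap : (Finset.univ.filter fun b : Fin M => b ≠ a ∧ dist ((y ∘ φ) b) ((y ∘ φ) a) ≤ r).map ⟨φ, hφ⟩ =
      Finset.univ.filter fun k : Fin N => k ≠ φ a ∧ dist (y k) (y (φ a)) ≤ r := by
    ext j
    simp only [Finset.mem_map, Finset.mem_filter, Finset.mem_univ, true_and, Function.Embedding.coeFn_mk,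
      Function.comp_apply]
    constructor
    · rintro ⟨b, ⟨hb1, hb2⟩, rfl⟩
      exact ⟨hφ.ne hb1, hb2⟩
    · rintro ⟨hj1, hj2⟩
      obtain ⟨b, rfl⟩ := hsub j (hj2.trans hr)
      exact ⟨b, ⟨fun h => hj1 (congrArg φ h), hj2⟩, rfl⟩
  rw [← hmap, Finset.card_map]

/-- ★ `truncEnergyFeature r` is `ρ`-local for `r ≤ ρ`. [folklore] -/
theorem truncEnergyFeature_isLocal {r ρ : ℝ} (hr : r ≤ ρ) : IsLocalFeature ρ (truncEnergyFeature r) := by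
  intro N M y φ hφ a hsub
  unfold truncEnergyFeature
  exact sum_comp_eq_sum_of_vanish hφ (fun k : Fin N => truncLJ r (dist (y (φ a)) (y k))) fun j hj => by
    have hfar : ρ < dist (y j) (y (φ a)) := lt_of_not_ge fun hh => hj (hsub j hh)
    exact truncLJ_of_le (by rw [dist_comm]; linarith)

/-! ## §2. Pair rules built from a local feature -/

/-- **`pairRule g f`**: site `i` sends `g (dist (y i) (y j)) (f_i) (f_j)` to every OTHER site `j` (nothing to itself). -/
def pairRule (g : ℝ → ℝ → ℝ → ℝ) (f : SiteFeature) : TransferRule :=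
  fun N y i j => if i = j then 0 else g (dist (y i) (y j)) (f N y i) (f N y j)

/-- **Range**: if `g d a b = 0` whenever `d > R′`, then `pairRule g f` has range `R′`. [folklore] -/
theorem pairRule_hasRange {R' : ℝ} {g : ℝ → ℝ → ℝ → ℝ} {f : SiteFeature} (hg : ∀ d a b, R' < d → g d a b = 0) :
    HasRange R' (pairRule g f) := by
  intro N y i j hd
  unfold pairRule
  split_ifs
  · rfl
  · exact hg _ _ _ hd

/-- ★ **Locality**: a `ρ`-local feature gives a `ρ`-local pair rule (the pair distance itself is always available). [folklore] -/
theorem pairRule_isLocal {ρ : ℝ} {g : ℝ → ℝ → ℝ → ℝ} {f : SiteFeature} (hf : IsLocalFeature ρ f) : IsLocal ρ (pairRule g f) := by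
  intro N M y φ hφ a b hsub
  unfold pairRule
  have ha : f M (y ∘ φ) a = f N y (φ a) := hf N M y φ hφ a fun k hk => hsub k (Or.inl hk)
  have hb : f M (y ∘ φ) b = f N y (φ b) := hf N M y φ hφ b fun k hk => hsub k (Or.inr hk)
  simp only [Function.comp_apply, hφ.eq_iff, ha, hb]

/-- **Bound**: `|g| ≤ B` (with `B ≥ 0`) gives `IsBounded B (pairRule g f)`. [folklore] -/
theorem pairRule_isBounded {B : ℝ} (hB : 0 ≤ B) {g : ℝ → ℝ → ℝ → ℝ} {f : SiteFeature} (hg : ∀ d a b, |g d a b| ≤ B) :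
    IsBounded B (pairRule g f) := by
  intro N y i j
  unfold pairRule
  split_ifs
  · simpa using hB
  · exact hg _ _ _

/-- ★ **All three restrictions at once** for a clipped finite-range pair rule on a local feature: the certified search space
«`g` vanishing beyond `R′` and bounded by `B`, `f` `ρ`-local» ⊆ `HasRange R′ ∧ IsLocal ρ ∧ IsBounded B`. [folklore] -/
theorem pairRule_restricted {R' ρ B : ℝ} (hB : 0 ≤ B) {g : ℝ → ℝ → ℝ → ℝ} {f : SiteFeature}
    (hgR : ∀ d a b, R' < d → g d a b = 0) (hgB : ∀ d a b, |g d a b| ≤ B) (hf : IsLocalFeature ρ f) :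
    HasRange R' (pairRule g f) ∧ IsLocal ρ (pairRule g f) ∧ IsBounded B (pairRule g f) :=
  ⟨pairRule_hasRange hgR, pairRule_isLocal hf, pairRule_isBounded hB hgB⟩

/-- **Example (certified search-space member)**: «clipped energy flow from rich to poor within `R′`» —
`g d a b = 𝟙[d ≤ R′] · max (−B) (min B (κ·(a − b)))` on the feature `truncEnergyFeature r`, `r ≤ ρ`: range `R′`, locality `ρ`, bound `B`. [folklore] -/
theorem energyFlowRule_restricted {R' ρ r B κ : ℝ} (hB : 0 ≤ B) (hr : r ≤ ρ) :
    let g : ℝ → ℝ → ℝ → ℝ := fun d a b => if d ≤ R' then max (-B) (min B (κ * (a - b))) else 0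
    HasRange R' (pairRule g (truncEnergyFeature r)) ∧ IsLocal ρ (pairRule g (truncEnergyFeature r)) ∧
      IsBounded B (pairRule g (truncEnergyFeature r)) := by
  refine pairRule_restricted hB (fun d a b hd => ?_) (fun d a b => ?_) (truncEnergyFeature_isLocal hr)
  · simp only [if_neg (not_le.mpr hd)]
  · split_ifs
    · exact abs_le.mpr ⟨le_max_left _ _, max_le (by linarith) (min_le_left _ _)⟩
    · simpa using hB

end Summit.AtomisticToContinuum.Crystallization.Theorems.FrustratedLawDichotomyRuleToolkit

end
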